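import Summits.CriticalPhenomena.PercolationContinuityZ3.Theorems.PercNearOneGluingNoHeavyLowerTailSunflowerPurePayer
import HarnessLib
import HarnessLib.Audit

/-!
# `NoHeavyLowerTail` (crux stmt-CriticalPhenomena-4575), abstract sunflower cubic: the CORRECTED LEMMA B and the KERNEL-PAIR BOUND —
# Lemma B corrected by the kernel-completing forced triples (census-true for every petal), and the exact split of ★ into bottom and kernel halves

Support file (seat `prim-l12-p2` gen 14; `--supports stmt-CriticalPhenomena-4575`).  Nothing is asserted about the crux; no `sorry`; the
`@[conjecture]` definition is an obligation of this programme, never a fact — use it only as an explicit hypothesis.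
Memo: run/shared/lean/prim/prim-l12/prim-l12-p2/FINDING-g14-SPECTATOR-NOGO-AND-IX-CALCULUS.md §8 (census: kit j120850 + seat folder code/lbtest*.c).

SETTING (`Sunflower`: up-sets `V 0, V 1, V 2 ⊆ 2^α` with all pairwise intersections `= A`; labels `0` bottom, `1,2,3` petals, `4 = ⊤` kernel;
ordered 3-partitions `(P,Q,R)`, `R = (P ∪ Q)ᶜ`).  Recall `ZH = 3·(SA + SB) − Ntri` (`Sunflower.ZH_eq_SA_SB`): the partition lemma ★
(`PartitionLemmaH`, OPEN; ⇒ `H_{q+t}`, `GammaRow`) says that the antipodal-Gladkov surpluses of the kernel spectators (`SA ≥ 0`) and of the bottom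
spectators (`SB ≥ 0`) pay for the ordered rainbow partitions `Ntri`.  "Lemma B" (`Ntri ≤ 3·SB`) is FALSE (doubled star), "Lemma A" (`Ntri ≤ 3·SA`)
is false, and even the dichotomy `PurePayer` ("A or B") is FALSE (cyclic star `CS(3,3,3)`: `SA = 432`, `SB = 326`, `Ntri = 1302`,
`…SunflowerPurePayerRefutation`).

THE NEW COUNT.  For a petal label `ℓ ∈ {1,2,3}` let `FO4 ℓ` be the number of ordered 3-partitions `(P,Q,R)` with
  `lab P = 0`, `lab Q = ℓ`, `lab R = ⊤`, `R ⊇ T` for some petal set `T` (`lab T = ℓ`)  ["the kernel block is FORCED by petal `ℓ`"],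
  and `lab (P ∪ Q) = ⊤`  ["the bottom block COMPLETES the petal block to a kernel set"].
Equivalently: complementary kernel pairs `(P ∪ Q, R)` of the ground set, the second above a petal-`ℓ` set, together with a splitting of the
first into a petal-`ℓ` set and a bottom set.  `FO4 ℓ = 0` whenever petal `ℓ` is an intersecting family (`FO4_eq_zero_of_intersecting`).

TYPED CONJECTURE (this work; census: 0 violations in 5.5·10⁶ θ-pullbacks of random / adversarially hill-climbed up-set triples on 5–10
points (kit j120850 + seat runs) and on the structured families of the lane — doubled/tripled star, cyclic stars `CS(2)`, `CS(3)`, three-hub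
`TH(L)`, products, perturbed (co)products; minimum slack exactly `0`):
* `CorrectedLemmaB`:  `Ntri ≤ 3·SB + 6·FO4 ℓ` for EVERY petal `ℓ` — Lemma B corrected by the kernel-completing forced triples.  It is tight
  on product-type compositions (where `FO4 = 0` and Lemma B is an identity) and yields plain Lemma B — hence ★, since `SA ≥ 0` — for every
  sunflower having a petal with `FO4 ℓ = 0`: every INTERSECTING petal (`FO4_eq_zero_of_intersecting`; this is the conclusion gen 13 proved for
  centred petals and conjectured via `IX-gen` for intersecting ones), but also e.g. the three-hub family `TH(L)` (non-intersecting, `FO4 = 0`).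
THE KERNEL HALF.  By the identity `ZH = (3·SB + 6·FO4 ℓ − Ntri) + 3·(SA − 2·FO4 ℓ)` (`ZH_eq_corrected_split`, any `ℓ`), ★ follows from
`CorrectedLemmaB` on every sunflower with `2·FO4 ℓ ≤ SA` for some `ℓ` (`ZH_nonneg_of_correctedB_of_kernelPair`); this kernel-pair bound holds
with EQUALITY `SA = 2·FO4 ℓ` on the doubled and tripled star, `CS(2)`, `CS(3)` (where Lemma A, Lemma B and `PurePayer` all fail), `TH(L)` and
all products, but it is NOT universal: the 7-point triple `U₁ = ↑{12, 06}`, `U₂ = ↑{25, 35, 24, 13}`, `U₃ = ↑{34, 15}` has `SA = 10`,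
`(FO4 1, FO4 2, FO4 3) = (6, 10, 6)` (while `SB = 326`, `Ntri = 12`, `ZH = 996`) — so the kernel half must be allowed to borrow from the
bottom half, and only the B-half is filed as a conjecture.  Gen-14's no-go (memo §2): neither half can be certified by label-level two-copy
spectator rows; `FO4` is "inside-block" information (containment of petal sets, the label of a union of two blocks).
-/

namespace Summit.CriticalPhenomena.PercolationContinuityZ3.Theorems.SunflowerPartition

open Finset

variable {α : Type*} [Fintype α] [DecidableEq α]

namespace Sunflower

variable (F : Sunflower α)

/-- `FO4 ℓ`: the number of ordered 3-partitions `(P, Q, R = (P ∪ Q)ᶜ)` with `P` bottom, `Q` in petal `ℓ`, `R` a kernel set containing a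
petal-`ℓ` set, and `P ∪ Q` a kernel set ("kernel-completing forced triples" of petal `ℓ`). [this work] -/
noncomputable def FO4 (ℓ : Fin 5) : ℤ := by
  classical
  exact ∑ q ∈ parts α,
    (if F.lab q.1 = 0 ∧ F.lab q.2 = ℓ ∧ F.lab (q.1 ∪ q.2)ᶜ = 4 ∧ F.lab (q.1 ∪ q.2) = 4 ∧
        (∃ T : Finset α, F.lab T = ℓ ∧ T ⊆ (q.1 ∪ q.2)ᶜ) then (1 : ℤ) else 0)

/-- `FO4 ℓ ≥ 0`. [this work] -/
theorem FO4_nonneg (ℓ : Fin 5) : 0 ≤ F.FO4 ℓ := by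
  classical
  unfold FO4
  exact sum_nonneg fun q _ => by split_ifs <;> norm_num

/-- **The corrected split of the partition functional**: for every petal label `ℓ`,
`ZH = (3·SB + 6·FO4 ℓ − Ntri) + 3·(SA − 2·FO4 ℓ)`. [this work] -/
theorem ZH_eq_corrected_split (ℓ : Fin 5) :
    F.ZH = (3 * F.SB + 6 * F.FO4 ℓ - F.Ntri) + 3 * (F.SA - 2 * F.FO4 ℓ) := by
  rw [F.ZH_eq_SA_SB]; ring

/-- If petal `ℓ` is an INTERSECTING family (no two disjoint petal-`ℓ` sets) then `FO4 ℓ = 0`: the petal block `Q` and a petal-`ℓ` set inside the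
kernel block `R` would be disjoint. [this work] -/
theorem FO4_eq_zero_of_intersecting {ℓ : Fin 5}
    (hint : ∀ S T : Finset α, F.lab S = ℓ → F.lab T = ℓ → ¬ Disjoint S T) : F.FO4 ℓ = 0 := by
  classical
  unfold FO4
  refine sum_eq_zero fun q hq => ?_
  rw [if_neg]
  rintro ⟨_, hQ, _, _, T, hT, hTR⟩
  apply hint q.2 T hQ hT
  -- `T ⊆ (q.1 ∪ q.2)ᶜ` is disjoint from `q.2`
  rw [Finset.disjoint_left]
  intro x hxQ hxT
  have hx := hTR hxT
  rw [mem_compl, mem_union, not_or] at hx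
  exact hx.2 hxQ

end Sunflower

/-- **CORRECTED LEMMA B** (this work; OPEN, census-true, memo §8): for every finite sunflower and EVERY petal label `ℓ ∈ {1,2,3}`,
`Ntri ≤ 3·SB + 6·FO4 ℓ` — the bottom-spectator Gladkov surplus pays for the rainbows up to the kernel-completing forced triples of petal `ℓ`.
Identity-tight on product-type compositions; reduces to the (false in general, true here) Lemma B when `FO4 ℓ = 0`.
An obligation, never a fact: use as `(h : CorrectedLemmaB)`. [status: open] -/
@[conjecture] def CorrectedLemmaB : Prop :=
  ∀ (α : Type) [Fintype α] [DecidableEq α] (F : Sunflower α) (ℓ : Fin 5), (ℓ = 1 ∨ ℓ = 2 ∨ ℓ = 3) →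
    F.Ntri ≤ 3 * F.SB + 6 * F.FO4 ℓ

/-- **Reduction, kernel half supplied per sunflower**: under `CorrectedLemmaB`, every sunflower with `2·FO4 ℓ ≤ SA` for some petal label `ℓ`
satisfies the partition lemma `0 ≤ ZH` (equality `SA = 2·FO4 ℓ` holds on the doubled / tripled star, the cyclic stars and the three-hub family;
the bound is not universal, see the file docstring). [this work] -/
theorem Sunflower.ZH_nonneg_of_correctedB_of_kernelPair (hB : CorrectedLemmaB) {α : Type} [Fintype α] [DecidableEq α] (F : Sunflower α)
    {ℓ : Fin 5} (hℓ : ℓ = 1 ∨ ℓ = 2 ∨ ℓ = 3) (hA : 2 * F.FO4 ℓ ≤ F.SA) : 0 ≤ F.ZH := by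
  have hBℓ := hB α F ℓ hℓ
  rw [F.ZH_eq_corrected_split ℓ]
  have h1 : 0 ≤ 3 * F.SB + 6 * F.FO4 ℓ - F.Ntri := by linarith
  have h2 : 0 ≤ F.SA - 2 * F.FO4 ℓ := by linarith
  linarith

/-- Under `CorrectedLemmaB`, plain Lemma B (`Ntri ≤ 3·SB`, hence `0 ≤ ZH` by `SA ≥ 0`) holds for every sunflower having a petal with
`FO4 ℓ = 0` — in particular an intersecting petal (`FO4_eq_zero_of_intersecting`). [this work] -/
theorem lemmaB_of_correctedB_of_FO4_eq_zero (hB : CorrectedLemmaB) {α : Type} [Fintype α] [DecidableEq α] (F : Sunflower α)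
    {ℓ : Fin 5} (hℓ : ℓ = 1 ∨ ℓ = 2 ∨ ℓ = 3) (h0 : F.FO4 ℓ = 0) : F.Ntri ≤ 3 * F.SB ∧ 0 ≤ F.ZH := by
  have h := hB α F ℓ hℓ
  rw [h0] at h
  refine ⟨by linarith, ?_⟩
  rw [F.ZH_eq_SA_SB]
  have := F.SA_nonneg
  linarith

/-- Under `CorrectedLemmaB`, Lemma B and the partition lemma hold for every sunflower with an INTERSECTING petal (no two disjoint petal-`ℓ`
sets) — the target of the `IX-gen` programme of gen 13, here a one-line consequence. [this work] -/
theorem Sunflower.ZH_nonneg_of_correctedB_of_intersecting (hB : CorrectedLemmaB) {α : Type} [Fintype α] [DecidableEq α] (F : Sunflower α)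
    {ℓ : Fin 5} (hℓ : ℓ = 1 ∨ ℓ = 2 ∨ ℓ = 3) (hint : ∀ S T : Finset α, F.lab S = ℓ → F.lab T = ℓ → ¬ Disjoint S T) :
    F.Ntri ≤ 3 * F.SB ∧ 0 ≤ F.ZH :=
  lemmaB_of_correctedB_of_FO4_eq_zero hB F hℓ (F.FO4_eq_zero_of_intersecting hint)

end Summit.CriticalPhenomena.PercolationContinuityZ3.Theorems.SunflowerPartition
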